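import Mathlib
import HarnessLib
import Summits.HubbardSuperconductivity.HubbardSuperconductivity.Theorems.KLProgrammeKLRegimeSplitCounterMap
import Summits.HubbardSuperconductivity.HubbardSuperconductivity.Theorems.KLProgrammeKLRegimeSplitBundleV6

/-!
# Route `KLProgramme` — child `KLRegimeCounterterm` (gen 3, stmt-HubbardSuperconductivity-19825): frames with a first-derivative bound on
# `Momentum` are LIPSCHITZ on `Fin 2 → ℝ` in the `ℓ¹` metric — the `Λ_K` input of p1b's off-lattice wiggle lemma `abs_eval_klFrameExtG_sub_le`
# read off (E3a-G) `TwoLegSizesG` (order `j = 1`) for the G-pieces (seat hubbard-kl-k3c3-p3; input (I2) of k3c3-p2's continuation, polynomial side)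

* `abs_eval_sub_eval_le_of_norm_iteratedFDeriv_one_le` — if `‖D¹(evalM A)(q)‖ ≤ B` at every `q : Momentum`, then
  `|A.eval p − A.eval p′| ≤ B·(|p₀ − p′₀| + |p₁ − p′₁|)` for all `p p′ : Fin 2 → ℝ` (mean value inequality on `EuclideanSpace ℝ (Fin 2)` +
  `‖·‖₂ ≤ ‖·‖₁`);
* `abs_eval_klTwoLegPieceG_sub_le_of_sizes` — (E3a-G) tier 1 at scale `n` ⇒ the piece `ℓ_n^G(K)` is `twoLegBar G Q U 1 n`-Lipschitz in that
  metric (the shape of `hLipK` in `…CountertermFrameExtGWiggle`).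

Proofs only; nothing is asserted about the Hubbard model.
-/

noncomputable section

namespace Summit.HubbardSuperconductivity.HubbardSuperconductivity.Theorems.KLRegimeSplit

set_option linter.dupNamespace false -- summit = problem name (single-conjunct summit), D-0017

open Real
open Literature.MathematicalPhysics.QuantumLattice Literature.Probability.LatticeModels
open Summit.HubbardSuperconductivity.HubbardSuperconductivity.Theorems.KLProgrammeLegKernels
open Summit.HubbardSuperconductivity.HubbardSuperconductivity.Theorems.DispersionFlow

/-- The Euclidean norm of a plane vector is at most its `ℓ¹` size: `‖toLp 2 v‖ ≤ |v₀| + |v₁|`. -/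
theorem norm_toLp_two_le_abs_add_abs (v : Fin 2 → ℝ) : ‖(WithLp.toLp 2 v : Momentum)‖ ≤ |v 0| + |v 1| := by
  rw [EuclideanSpace.norm_eq, Fin.sum_univ_two]
  simp only [Real.norm_eq_abs]
  rw [Real.sqrt_le_left (by positivity)]
  nlinarith [abs_nonneg (v 0), abs_nonneg (v 1)]

/-- **A frame with `‖D¹(evalM A)‖ ≤ B` on `Momentum` is `B`-Lipschitz on `Fin 2 → ℝ` in the `ℓ¹` metric**:
`|A.eval p − A.eval p′| ≤ B·(|p₀ − p′₀| + |p₁ − p′₁|)`. -/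
theorem abs_eval_sub_eval_le_of_norm_iteratedFDeriv_one_le (A : TrigPolyC4v) {B : ℝ}
    (hB : ∀ q : Momentum, ‖iteratedFDeriv ℝ 1 (evalM A) q‖ ≤ B) (p p' : Fin 2 → ℝ) :
    |A.eval p - A.eval p'| ≤ B * (|p 0 - p' 0| + |p 1 - p' 1|) := by
  have hdiff : Differentiable ℝ (evalM A) := (contDiff_evalM A (k := 1)).differentiable (by norm_num)
  have hB' : ∀ q : Momentum, ‖fderiv ℝ (evalM A) q‖ ≤ B := fun q => by
    rw [← norm_iteratedFDeriv_one (𝕜 := ℝ) (f := evalM A)]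
    exact hB q
  have hB0 : 0 ≤ B := (norm_nonneg _).trans (hB (WithLp.toLp 2 p))
  have h := Convex.norm_image_sub_le_of_norm_fderiv_le (s := Set.univ) (f := evalM A) (fun x _ => hdiff x) (fun x _ => hB' x)
    convex_univ (Set.mem_univ (WithLp.toLp 2 p')) (Set.mem_univ (WithLp.toLp 2 p))
  have he : evalM A (WithLp.toLp 2 p) - evalM A (WithLp.toLp 2 p') = A.eval p - A.eval p' := rfl
  rw [he, Real.norm_eq_abs] at h
  refine h.trans ?_
  have hsub : (WithLp.toLp 2 p : Momentum) - WithLp.toLp 2 p' = WithLp.toLp 2 (p - p') := by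
    rw [WithLp.toLp_sub]
  rw [hsub]
  have hn := norm_toLp_two_le_abs_add_abs (p - p')
  simp only [Pi.sub_apply] at hn
  exact mul_le_mul_of_nonneg_left hn hB0

section Model

variable {L M : ℕ} [NeZero L] [NeZero M]

/-- **(E3a-G) tier 1 ⇒ the G-piece is Lipschitz in the `ℓ¹` metric**: `|ℓ_n^G(K)(p) − ℓ_n^G(K)(p′)| ≤ twoLegBar G Q U 1 n·(|p₀ − p′₀| + |p₁ − p′₁|)`
— the `hLipK` input of the wiggle lemma for the scale-`n` piece. -/
theorem abs_eval_klTwoLegPieceG_sub_le_of_sizes {G : GeoConsts} {Q : EngConsts} {R : RenConsts} {β U μ : ℝ} {K : TrigPolyC4v} {n : ℕ}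
    (h : TwoLegSizesG L M G Q R β U μ K n) (p p' : Fin 2 → ℝ) :
    |(klTwoLegPieceG L M β U μ K n).eval p - (klTwoLegPieceG L M β U μ K n).eval p'| ≤
      twoLegBar G Q U 1 n * (|p 0 - p' 0| + |p 1 - p' 1|) :=
  abs_eval_sub_eval_le_of_norm_iteratedFDeriv_one_le _ (fun q => h.1 1 (by norm_num) q) p p'

/-- The same from the «G» two-leg step (its first conjunct is (E3a-G)). -/
theorem abs_eval_klTwoLegPieceG_sub_le_of_stepG {hist : TrigPolyC4v → ℕ → Prop} {G : GeoConsts} {P : SplitConsts} {Q : EngConsts}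
    {R : RenConsts} {β U μ : ℝ} {K : TrigPolyC4v} {n : ℕ} (h : TwoLegStepG L M hist G P Q R β U μ K n) (p p' : Fin 2 → ℝ) :
    |(klTwoLegPieceG L M β U μ K n).eval p - (klTwoLegPieceG L M β U μ K n).eval p'| ≤
      twoLegBar G Q U 1 n * (|p 0 - p' 0| + |p 1 - p' 1|) :=
  abs_eval_klTwoLegPieceG_sub_le_of_sizes h.1 p p'

end Model

end Summit.HubbardSuperconductivity.HubbardSuperconductivity.Theorems.KLRegimeSplit

end
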